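import Mathlib
import Summits.QuantumFields.YangMills.Theorems.BalabanUVNodesN15BlockMean
import Literature.Analysis.Calculus.CenterLipschitzLocalNewton
import HarnessLib

/-!
# Route «BalabanUVNodes» (cluster K4 «SpineRates»), Track-A DAG node N15 = spine estimate NE2, BACKGROUND LAYER — FIRST MISSING
# ESTIMATE, part 12c: COEFFICIENT SPECIES S1 — spacing-dependent NONLINEAR coefficient maps `Φ(η, A(b))` (the print's transporter
# coefficient `η⁻¹(e^{iη ad A} − 1)` of (3.50) and `F′_{1,k}(z) = η⁻²(e^{ηz} − 1 − ηz)` of (3.51)–(3.52), real scalar models): fit = `K`·(fit of the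
# field) + `2K′·η` from a `z`-Lipschitz letter `K` and a spacing-consistency letter `K′`, both COMPUTED in the print's regime `η|A| ≤ 1`

Cell `pub-ymgap`, seat `pub-ymgap-dag-n15-b` (generation g2; FIRST-MISSING-ESTIMATE, HUMAN RULING D-0062; chair R424 venue; ROSTER-D0062
l.26).  `bears_on: R4∕N15`.  Filed `--supports stmt-QuantumFields-19351`.  Base file: 12a `BalabanUVNodesN15BlockMean` (block mean, species S0
`fit_blockMean`, `abs_blockMean_le`).

WHY.  In [Balaban1985BackgroundPropagators] (3.50)–(3.52) p. 400 (verbatim, first-hand): (3.50) *«η^{−2}(2dλ(x) − Σ_{b∈st(x)} exp(iη ad_{A′(b)})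
R(U_b)λ(b₊))»*, (3.51) *«where F′_{1,k}(z) = η^{−2}(e^{ηz} − 1 − ηz) = z²∫₀¹dt(1 − t)e^{ηtz}, hence F′_{1,k}(i ad_{A′(b)}) is an analytic function
of A(b)»*, (3.52) *«… + Σ_{b∈st(x)} F′_{1,k}(i ad_{A′(b)}) λ(b₊)»*: two coefficient species are NONLINEAR in the field WITH THE SPACING `η`
INSIDE the map.  Under the η-pairing the fine coefficient is `Φ(η′, A′(b′))`, the coarse one `Φ(η, Ā(πb′))`: their fit is the field's fit seen
through `Φ(η′, ·)` PLUS the spacing discrepancy `Φ(η′, z) − Φ(η, z)` at a fixed field value — both of rate one (the record `t4/T4-EST-U1a.md`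
§3 STEP 2: *«multiplication operators built from A … their pull-back discrepancy is ≤ (η-scale variation of A′) … RELATIVE size (η∕L^jη)·O(1)»*,
here with the spacing-inside-the-map term made explicit).  THE PRINT USED (SHAPES only): (3.35) p. 396; (3.50)–(3.52) p. 400; the regime
`η·|A| ≤ η·O(1)Mα₀(L^jη)^{−1} ≤ O(1)Mα₀ ≤ a₀` small (p. 397: *«We will need α₀ so small that O(1)Mα₀ is still a sufficiently small number»*)
is the box `η₀·r ≤ 1` of the letters.  Nothing of [B9] asserted.

CONTENTS (all [folklore]: one-variable calculus — mean value theorem, Mathlib `Real.abs_exp_sub_one_le` ∕ `Real.abs_exp_sub_one_sub_id_le` ∕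
`Real.exp_bound` — and finite means).
* §1 `fit_nonlinear` (generic, any pairing `π`): letters `K` (`z`-Lipschitz on `|z| ≤ r`, uniformly in `0 ≤ η ≤ η₀`) and `K′` (CONSISTENCY
  `|Φ(η, z) − Φ(0, z)| ≤ K′η`) ⟹ `|Φ(η′, a′x′) − Φ(η, a(πx′))| ≤ K·o(πx′) + 2K′·η` for fields of size `≤ r`, `0 ≤ η′ ≤ η ≤ η₀`.
* §2 the two printed species as real scalar maps: `phi1 η z = η⁻¹(e^{ηz} − 1)` (`phi1 0 z = z`), `phi2 η z = η⁻²(e^{ηz} − 1 − ηz)`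
  (`phi2 0 z = z²∕2`); the letters in the regime `η₀r ≤ 1`: `phi1_lipschitz` (`K = e`, by the tree's
  `Literature.Analysis.Calculus.expExample_lipschitz` — `exp` is `e`-Lipschitz on `[−1,1]` — BY NAME),
  `phi1_consistency` (`K′ = r²`), `hasDerivAt_phi2`, `phi2_lipschitz` (`K = 2r`), `phi2_consistency` (`K′ = r³`).
* §3 END TO END on `ℤ^d` with the block-mean transport: `fit_phi1_blockMean`, `fit_phi2_blockMean` (letters `|a′| ≤ r` and
  `T4EtaRateCoeffDefect.InBlockBondBound M a′ θ₁`), in the `hfit` shape (plug: 12a `hfit_of_pointwise`); `species1_rate`; rate readings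
  `rate_reading_phi1` (`(e·d + 2C)·(Cℓ^{−1})·(η∕ℓ)`) and `rate_reading_phi2` (`(2d + 2C)·(C²ℓ^{−2})·(η∕ℓ)`): `O(1)` × the species' own bound ×
  ONE rate factor `η∕ℓ`, `γ = 1` ((R1) of the record).

HONEST FRAMING ∕ LIMITS.  MECHANISM over hypothesis-SHAPED letters; REAL SCALAR models of `𝔤`-valued coefficients acting through `ad` (the
matrix species need the same two letters for `z ↦ F(i ad z)` in operator norm — not here); linearised transport; `ℤ^d`; crude constants.  NE2⁺
NOT PRINTED, NOT proved; count-neutral (typed 28∕28; nothing discharged); one finite T⁴ at fixed ε — NOT infinite volume, NOT OS on ℝ⁴, NOT a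
mass gap, NOT Clay.
-/

noncomputable section

namespace Summit.QuantumFields.YangMills.BalabanUVNodes.N15.CoefficientSpecies

open Literature.MathematicalPhysics.QuantumFieldTheory.Balaban1983to89
open Literature.MathematicalPhysics.QuantumFieldTheory.Balaban1983to89.T4EtaRateCoeffDefect (InBlockBondBound coeff_osc_rate)
open Literature.MathematicalPhysics.QuantumLattice (blockMap)
open Literature.Probability.LatticeModels (Site)

variable {d : ℕ}

/-! ## §1–§3 Species S1: nonlinear spacing-dependent coefficient maps -/

section Species1

variable {X X' : Type*}

/-- SPECIES S1 (generic).  A coefficient map `Φ(η, z)` (spacing `η`, field value `z`) with two letters on the box `0 ≤ η ≤ η₀`, `|z| ≤ r`: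
`z`-LIPSCHITZ constant `K ≥ 0`, and SPACING CONSISTENCY `|Φ(η, z) − Φ(0, z)| ≤ K′·η`, `K′ ≥ 0`.  For a fine field `a′` and a coarse field `a`
both of size `≤ r`, spacings `0 ≤ η′ ≤ η ≤ η₀`, and the species-S0 fit `|a′(x′) − a(πx′)| ≤ o(πx′)`:
`|Φ(η′, a′x′) − Φ(η, a(πx′))| ≤ K·o(πx′) + 2K′·η` — the fit of the field PLUS the spacing inside the map, both of rate one. [folklore] -/
theorem fit_nonlinear (π : X' → X) (Φ : ℝ → ℝ → ℝ) {η₀ r K K' η η' : ℝ} (hK : 0 ≤ K) (hK' : 0 ≤ K')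
    (hLz : ∀ s, 0 ≤ s → s ≤ η₀ → ∀ z₁ z₂, |z₁| ≤ r → |z₂| ≤ r → |Φ s z₁ - Φ s z₂| ≤ K * |z₁ - z₂|)
    (hCη : ∀ s, 0 ≤ s → s ≤ η₀ → ∀ z, |z| ≤ r → |Φ s z - Φ 0 z| ≤ K' * s)
    (hη' : 0 ≤ η') (hη'η : η' ≤ η) (hη : η ≤ η₀)
    {a' : X' → ℝ} {a : X → ℝ} (ha' : ∀ x', |a' x'| ≤ r) (ha : ∀ x, |a x| ≤ r)
    {o : X → ℝ} (hfit : ∀ x', |a' x' - a (π x')| ≤ o (π x')) (x' : X') :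
    |Φ η' (a' x') - Φ η (a (π x'))| ≤ K * o (π x') + 2 * K' * η := by
  have h1 : |Φ η' (a' x') - Φ η' (a (π x'))| ≤ K * o (π x') :=
    (hLz η' hη' (hη'η.trans hη) _ _ (ha' x') (ha _)).trans (mul_le_mul_of_nonneg_left (hfit x') hK)
  have h2 : |Φ η' (a (π x')) - Φ 0 (a (π x'))| ≤ K' * η' := hCη η' hη' (hη'η.trans hη) _ (ha _)
  have h3 : |Φ 0 (a (π x')) - Φ η (a (π x'))| ≤ K' * η := by
    rw [abs_sub_comm]; exact hCη η (hη'.trans hη'η) hη _ (ha _)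
  have hmono : K' * η' ≤ K' * η := mul_le_mul_of_nonneg_left hη'η hK'
  calc |Φ η' (a' x') - Φ η (a (π x'))|
      = |(Φ η' (a' x') - Φ η' (a (π x'))) + (Φ η' (a (π x')) - Φ 0 (a (π x'))) + (Φ 0 (a (π x')) - Φ η (a (π x')))| := by
        ring_nf
    _ ≤ |Φ η' (a' x') - Φ η' (a (π x'))| + |Φ η' (a (π x')) - Φ 0 (a (π x'))| + |Φ 0 (a (π x')) - Φ η (a (π x'))| :=
        (abs_add_le _ _).trans (add_le_add (abs_add_le _ _) le_rfl)
    _ ≤ K * o (π x') + K' * η' + K' * η := add_le_add (add_le_add h1 h2) h3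
    _ ≤ K * o (π x') + 2 * K' * η := by linarith

/-- THE TRANSPORTER SPECIES `phi1 η z = η⁻¹(e^{ηz} − 1)` (value `z` at `η = 0`): the real scalar model of the print's coefficient
`η⁻¹(exp(iη ad_{A(b)}) − 1)` in the covariant derivative (3.50). [folklore] -/
def phi1 (η z : ℝ) : ℝ := if η = 0 then z else (Real.exp (η * z) - 1) / η

/-- THE SECOND-ORDER SPECIES `phi2 η z = η⁻²(e^{ηz} − 1 − ηz)` (value `z²∕2` at `η = 0`): the real scalar model of the print's
*«F′_{1,k}(z) = η^{−2}(e^{ηz} − 1 − ηz)»* (3.51)–(3.52). [folklore] -/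
def phi2 (η z : ℝ) : ℝ := if η = 0 then z ^ 2 / 2 else (Real.exp (η * z) - 1 - η * z) / η ^ 2

/-- At zero spacing `phi1` is the identity (the continuum coefficient `A`). [folklore] -/
@[simp] theorem phi1_zero (z : ℝ) : phi1 0 z = z := by simp [phi1]

/-- At zero spacing `phi2` is `z²∕2`. [folklore] -/
@[simp] theorem phi2_zero (z : ℝ) : phi2 0 z = z ^ 2 / 2 := by simp [phi2]

/-- The product of two numbers of size `≤ η₀`, `≤ r` with `η₀r ≤ 1` has size `≤ 1` (the print's regime `η|A| ≤ O(1)Mα₀`). [folklore] -/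
theorem abs_mul_le_one {η₀ r s z : ℝ} (hreg : η₀ * r ≤ 1) (hs0 : 0 ≤ s) (hs : s ≤ η₀) (hz : |z| ≤ r) : |s * z| ≤ 1 := by
  rw [abs_mul, abs_of_nonneg hs0]
  have hr : 0 ≤ r := (abs_nonneg z).trans hz
  calc s * |z| ≤ η₀ * r := mul_le_mul hs hz (abs_nonneg z) (hs0.trans hs)
    _ ≤ 1 := hreg

/-- LETTER `K = e` for `phi1`: on `0 ≤ η ≤ η₀`, `|z| ≤ r`, `η₀r ≤ 1`, `phi1(η, ·)` is `e`-Lipschitz. [folklore] -/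
theorem phi1_lipschitz {η₀ r : ℝ} (hreg : η₀ * r ≤ 1) :
    ∀ s, 0 ≤ s → s ≤ η₀ → ∀ z₁ z₂, |z₁| ≤ r → |z₂| ≤ r → |phi1 s z₁ - phi1 s z₂| ≤ Real.exp 1 * |z₁ - z₂| := by
  intro s hs0 hs z₁ z₂ hz₁ hz₂
  have he : (1 : ℝ) ≤ Real.exp 1 := by have := Real.add_one_le_exp (1 : ℝ); linarith
  by_cases h0 : s = 0
  · subst h0
    simp only [phi1_zero]
    exact le_mul_of_one_le_left (abs_nonneg _) he
  · have hspos : 0 < s := lt_of_le_of_ne hs0 (Ne.symm h0)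
    have h1 := abs_mul_le_one hreg hs0 hs hz₁
    have h2 := abs_mul_le_one hreg hs0 hs hz₂
    have hrepr : phi1 s z₁ - phi1 s z₂ = (Real.exp (s * z₁) - Real.exp (s * z₂)) / s := by
      simp only [phi1, if_neg h0]
      field_simp
      ring
    rw [hrepr, abs_div, abs_of_pos hspos, div_le_iff₀ hspos]
    calc |Real.exp (s * z₁) - Real.exp (s * z₂)| ≤ Real.exp 1 * |s * z₁ - s * z₂| :=
          Literature.Analysis.Calculus.expExample_lipschitz h1 h2
      _ = Real.exp 1 * |z₁ - z₂| * s := by rw [← mul_sub, abs_mul, abs_of_pos hspos]; ring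

/-- LETTER `K′ = r²` for `phi1`: `|phi1(η, z) − z| = η⁻¹|e^{ηz} − 1 − ηz| ≤ η·z² ≤ r²·η` (Mathlib `Real.abs_exp_sub_one_sub_id_le`). [folklore] -/
theorem phi1_consistency {η₀ r : ℝ} (hreg : η₀ * r ≤ 1) :
    ∀ s, 0 ≤ s → s ≤ η₀ → ∀ z, |z| ≤ r → |phi1 s z - phi1 0 z| ≤ r ^ 2 * s := by
  intro s hs0 hs z hz
  by_cases h0 : s = 0
  · subst h0; simp
  · have hspos : 0 < s := lt_of_le_of_ne hs0 (Ne.symm h0)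
    have h1 := abs_mul_le_one hreg hs0 hs hz
    have hrepr : phi1 s z - phi1 0 z = (Real.exp (s * z) - 1 - s * z) / s := by
      rw [phi1_zero]
      simp only [phi1, if_neg h0]
      field_simp
    rw [hrepr, abs_div, abs_of_pos hspos, div_le_iff₀ hspos]
    have hz2 : z ^ 2 ≤ r ^ 2 := by
      have := abs_nonneg z
      nlinarith [hz, sq_abs z]
    calc |Real.exp (s * z) - 1 - s * z| ≤ (s * z) ^ 2 := Real.abs_exp_sub_one_sub_id_le h1
      _ = z ^ 2 * s * s := by ring
      _ ≤ r ^ 2 * s * s := by gcongr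

/-- The `z`-derivative of `phi2(η, ·)` for `η ≠ 0` is `phi1(η, ·)`: `d∕dz [η⁻²(e^{ηz} − 1 − ηz)] = η⁻¹(e^{ηz} − 1)`. [folklore] -/
theorem hasDerivAt_phi2 {s : ℝ} (hs : s ≠ 0) (z : ℝ) :
    HasDerivAt (fun w => phi2 s w) ((Real.exp (s * z) - 1) / s) z := by
  have hf : (fun w => phi2 s w) = fun w => (Real.exp (s * w) - 1 - s * w) / s ^ 2 := by
    funext w; simp [phi2, hs]
  rw [hf]
  have h1 : HasDerivAt (fun w => s * w) s z := by simpa using (hasDerivAt_id z).const_mul s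
  have h2 : HasDerivAt (fun w => Real.exp (s * w)) (Real.exp (s * z) * s) z := h1.exp
  have h3 : HasDerivAt (fun w => Real.exp (s * w) - 1 - s * w) (Real.exp (s * z) * s - 0 - s) z :=
    (h2.sub (hasDerivAt_const z 1)).sub h1
  have h4 := h3.div_const (s ^ 2)
  refine h4.congr_deriv ?_
  rw [sub_zero, show Real.exp (s * z) * s - s = (Real.exp (s * z) - 1) * s by ring, pow_two,
    mul_div_mul_right _ _ hs]

/-- LETTER `K = 2r` for `phi2`: on `0 ≤ η ≤ η₀`, `|z| ≤ r`, `η₀r ≤ 1`, `phi2(η, ·)` is `2r`-Lipschitz (mean value theorem with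
`|phi2′| = |phi1| ≤ 2|z|` by `Real.abs_exp_sub_one_le`; at `η = 0` directly). [folklore] -/
theorem phi2_lipschitz {η₀ r : ℝ} (hreg : η₀ * r ≤ 1) :
    ∀ s, 0 ≤ s → s ≤ η₀ → ∀ z₁ z₂, |z₁| ≤ r → |z₂| ≤ r → |phi2 s z₁ - phi2 s z₂| ≤ 2 * r * |z₁ - z₂| := by
  intro s hs0 hs z₁ z₂ hz₁ hz₂
  have hr : 0 ≤ r := (abs_nonneg _).trans hz₁
  by_cases h0 : s = 0
  · subst h0
    simp only [phi2_zero]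
    have hrepr : z₁ ^ 2 / 2 - z₂ ^ 2 / 2 = (z₁ + z₂) / 2 * (z₁ - z₂) := by ring
    rw [hrepr, abs_mul]
    refine mul_le_mul_of_nonneg_right ?_ (abs_nonneg _)
    rw [abs_div, abs_two]
    have := abs_add_le z₁ z₂
    linarith
  · have hmem : ∀ w : ℝ, |w| ≤ r → w ∈ Set.Icc (-r) r := fun w hw => ⟨(abs_le.1 hw).1, (abs_le.1 hw).2⟩
    have key := Convex.norm_image_sub_le_of_norm_hasDerivWithin_le (f := fun w => phi2 s w)
      (f' := fun w => (Real.exp (s * w) - 1) / s) (s := Set.Icc (-r) r) (C := 2 * r)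
      (fun w _ => (hasDerivAt_phi2 h0 w).hasDerivWithinAt)
      (fun w hw => by
        have hspos : 0 < s := lt_of_le_of_ne hs0 (Ne.symm h0)
        have hw' : |w| ≤ r := abs_le.2 hw
        have h1 := abs_mul_le_one hreg hs0 hs hw'
        rw [Real.norm_eq_abs, abs_div, abs_of_pos hspos, div_le_iff₀ hspos]
        calc |Real.exp (s * w) - 1| ≤ 2 * |s * w| := Real.abs_exp_sub_one_le h1
          _ = 2 * |w| * s := by rw [abs_mul, abs_of_pos hspos]; ring
          _ ≤ 2 * r * s := by gcongr)
      (convex_Icc _ _) (hmem z₂ hz₂) (hmem z₁ hz₁)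
    simpa [Real.norm_eq_abs] using key

/-- LETTER `K′ = r³` for `phi2`: `|phi2(η, z) − z²∕2| = η⁻²|e^{ηz} − 1 − ηz − (ηz)²∕2| ≤ η|z|³ ≤ r³·η` (Mathlib `Real.exp_bound`, three terms). [folklore] -/
theorem phi2_consistency {η₀ r : ℝ} (hreg : η₀ * r ≤ 1) :
    ∀ s, 0 ≤ s → s ≤ η₀ → ∀ z, |z| ≤ r → |phi2 s z - phi2 0 z| ≤ r ^ 3 * s := by
  intro s hs0 hs z hz
  by_cases h0 : s = 0
  · subst h0; simp
  · have hspos : 0 < s := lt_of_le_of_ne hs0 (Ne.symm h0)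
    have h1 := abs_mul_le_one hreg hs0 hs hz
    have hrepr : phi2 s z - phi2 0 z = (Real.exp (s * z) - 1 - s * z - (s * z) ^ 2 / 2) / s ^ 2 := by
      rw [phi2_zero]
      simp only [phi2, if_neg h0]
      field_simp
    have hs2 : 0 < s ^ 2 := by positivity
    rw [hrepr, abs_div, abs_of_pos hs2, div_le_iff₀ hs2]
    have hb := Real.exp_bound h1 (n := 3) (by norm_num)
    have hsum : ∑ m ∈ Finset.range 3, (s * z) ^ m / (m.factorial : ℝ) = 1 + s * z + (s * z) ^ 2 / 2 := by
      simp [Finset.sum_range_succ, Nat.factorial]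
    rw [hsum] at hb
    have hcube : |s * z| ^ 3 ≤ s ^ 3 * r ^ 3 := by
      rw [abs_mul, abs_of_pos hspos, mul_pow]
      have hr : 0 ≤ r := (abs_nonneg z).trans hz
      gcongr
    calc |Real.exp (s * z) - 1 - s * z - (s * z) ^ 2 / 2|
        = |Real.exp (s * z) - (1 + s * z + (s * z) ^ 2 / 2)| := by ring_nf
      _ ≤ |s * z| ^ 3 * ((Nat.succ 3 : ℕ) / ((Nat.factorial 3 : ℕ) * (3 : ℕ) : ℝ)) := hb
      _ ≤ |s * z| ^ 3 * 1 := by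
          gcongr
          norm_num [Nat.factorial]
      _ ≤ s ^ 3 * r ^ 3 := by rw [mul_one]; exact hcube
      _ = r ^ 3 * s * s ^ 2 := by ring

/-- The block mean of a field of size `≤ r` has size `≤ r` (the coarse field stays in the box of the letters). [folklore] -/
theorem abs_blockMean_le_of_forall {M : ℕ} (hM : 0 < M) {a' : Site d → ℝ} {r : ℝ} (ha' : ∀ x', |a' x'| ≤ r) (y : Site d) :
    |blockMean M a' y| ≤ r :=
  abs_blockMean_le hM fun _ _ => ha' _

/-- SPECIES S1 × TRANSPORTER, END TO END on `ℤ^d`: fine coefficient `phi1(η′, a′(x′))`, coarse coefficient `phi1(η, blockMean a′(⌊x′∕M⌋))`;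
letters `|a′| ≤ r` ((3.35) sup shape), `InBlockBondBound M a′ θ₁` ((3.35) gradient shape, `θ₁ ≥ 0`), regime `0 ≤ η′ ≤ η ≤ η₀`, `η₀r ≤ 1`:
`|phi1(η′, a′x′) − phi1(η, blockMean a′(⌊x′∕M⌋))| ≤ e·d(M−1)θ₁(⌊x′∕M⌋) + 2r²·η`. [folklore] -/
theorem fit_phi1_blockMean {M : ℕ} (hM : 0 < M) {η₀ r η η' : ℝ} (hreg : η₀ * r ≤ 1) (hη' : 0 ≤ η') (hη'η : η' ≤ η)
    (hη : η ≤ η₀) {a' : Site d → ℝ} (ha' : ∀ x', |a' x'| ≤ r) {θ₁ : Site d → ℝ} (hθ : ∀ y, 0 ≤ θ₁ y)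
    (h : InBlockBondBound M a' θ₁) (x' : Site d) :
    |phi1 η' (a' x') - phi1 η (blockMean M a' (blockMap M x'))| ≤
      Real.exp 1 * ((d : ℝ) * ((M : ℝ) - 1) * θ₁ (blockMap M x')) + 2 * r ^ 2 * η :=
  fit_nonlinear (blockMap M) phi1 (Real.exp_pos 1).le (sq_nonneg r) (phi1_lipschitz hreg) (phi1_consistency hreg) hη' hη'η hη
    ha'
    (abs_blockMean_le_of_forall hM ha') (o := fun y => (d : ℝ) * ((M : ℝ) - 1) * θ₁ y) (fit_blockMean hM hθ h) x'

/-- SPECIES S1 × `F′_{1,k}`, END TO END on `ℤ^d`: the same for `phi2` with its letters `K = 2r`, `K′ = r³`: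
`|phi2(η′, a′x′) − phi2(η, blockMean a′(⌊x′∕M⌋))| ≤ 2r·d(M−1)θ₁(⌊x′∕M⌋) + 2r³·η`. [folklore] -/
theorem fit_phi2_blockMean {M : ℕ} (hM : 0 < M) {η₀ r η η' : ℝ} (hreg : η₀ * r ≤ 1) (hr : 0 ≤ r) (hη' : 0 ≤ η') (hη'η : η' ≤ η)
    (hη : η ≤ η₀) {a' : Site d → ℝ} (ha' : ∀ x', |a' x'| ≤ r) {θ₁ : Site d → ℝ} (hθ : ∀ y, 0 ≤ θ₁ y)
    (h : InBlockBondBound M a' θ₁) (x' : Site d) :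
    |phi2 η' (a' x') - phi2 η (blockMean M a' (blockMap M x'))| ≤
      2 * r * ((d : ℝ) * ((M : ℝ) - 1) * θ₁ (blockMap M x')) + 2 * r ^ 3 * η :=
  fit_nonlinear (blockMap M) phi2 (by positivity) (by positivity) (phi2_lipschitz hreg) (phi2_consistency hreg) hη' hη'η hη
    ha'
    (abs_blockMean_le_of_forall hM ha') (o := fun y => (d : ℝ) * ((M : ℝ) - 1) * θ₁ y) (fit_blockMean hM hθ h) x'

/-- RATE READING of the transporter species ((R1) of the record): with the (3.35) SHAPES `θ₁ = η′G₁`, `G₁ = Cℓ^{−2}`, `r = Cℓ^{−1}` and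
`Mη′ = η`, the species-S1 defect `e·dηG₁ + 2r²η` is `(e·d + 2C) ×` (coefficient bound `Cℓ^{−1}`) `×` (rate factor `η∕ℓ`): `O(1)` for `C = O(1)Mα₀ ≤ 1`.
[folklore] -/
theorem rate_reading_phi1 (d : ℕ) {η C ℓ : ℝ} (hℓ : ℓ ≠ 0) :
    Real.exp 1 * ((d : ℝ) * η * (C * ℓ⁻¹ ^ 2)) + 2 * (C * ℓ⁻¹) ^ 2 * η =
      ((Real.exp 1 * d + 2 * C) * (C * ℓ⁻¹)) * (η / ℓ) := by
  field_simp

/-- RATE READING of the `F′_{1,k}` species: with the same shapes the species-S1 defect `2r·dηG₁ + 2r³η` is `(2d + 2C) ×` (coefficient bound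
`C²ℓ^{−2}` = the size of `F′_{1,k}(A) ≈ A²∕2`'s own bound) `×` (rate factor `η∕ℓ`). [folklore] -/
theorem rate_reading_phi2 (d : ℕ) {η C ℓ : ℝ} (hℓ : ℓ ≠ 0) :
    2 * (C * ℓ⁻¹) * ((d : ℝ) * η * (C * ℓ⁻¹ ^ 2)) + 2 * (C * ℓ⁻¹) ^ 3 * η =
      ((2 * d + 2 * C) * (C ^ 2 * ℓ⁻¹ ^ 2)) * (η / ℓ) := by
  field_simp

/-- The species-S1 bound with the rate inserted: `K·d(M−1)(η′G₁) + 2K′η ≤ (K·d·G₁ + 2K′)·η` (`K, G₁, η′ ≥ 0`, `Mη′ = η`). [folklore] -/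
theorem species1_rate (d M : ℕ) {η η' G₁ K K' : ℝ} (hK : 0 ≤ K) (hη' : 0 ≤ η') (hG₁ : 0 ≤ G₁) (hMη : (M : ℝ) * η' = η) :
    K * ((d : ℝ) * ((M : ℝ) - 1) * (η' * G₁)) + 2 * K' * η ≤ (K * d * G₁ + 2 * K') * η := by
  have h := coeff_osc_rate d M hη' hG₁ rfl hMη
  nlinarith [mul_le_mul_of_nonneg_left h hK]

end Species1

end Summit.QuantumFields.YangMills.BalabanUVNodes.N15.CoefficientSpecies
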